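import Summits.QuantumFields.BalabanUV.Beta.FP.PerfectPropagatorReflection
import Summits.QuantumFields.BalabanUV.Beta.FP.PerfectMaxwellDict

/-!
# `BalabanUV.Beta.FP.PerfectHessianColumnCovariance` — road «FP» for binder row D1, leaf (H2), row H2V-4 (R): THE LATTICE SYMMETRIES OF BAŁABAN's
# PERFECT EFFECTIVE LAPLACIAN `Δ_∞` AT KERNEL LEVEL — axis-PERMUTATION covariance `Δ_∞((σ•x, σα),(σ•y, σβ)) = Δ_∞((x,α),(y,β))` and the single-axis
# REFLECTION law `Δ_∞((cflip γ x, α),(0,β)) = ε_α ε_β · Δ_∞((x + [β=γ]e_γ − [α=γ]e_γ, α),(0,β))` — the remaining Hessian-side letters (a5) `hP`, `hF` (and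
# `Decays`) of the cubic-germ uniqueness theorem `AdmissibleCubicGerm.cubicGermOf_eq_smul_ymGerm_of_admissible` AT THE PERFECT DATA

HONEST DEPENDENCY (page 1, mandatory): continuum YM on T⁴ ⇐ BetaPertH ∧ nine spine estimates (0/9 proved); BetaPertH ⇐ (D1) ∧ (D4) ∧ CAP+tail;
G-an2-4 gates asym, D1 and NE2/3/4.  HONEST FRAMING (cell contract, verbatim): «discharging `BetaPertH` makes Bałaban's UV stability UNCONDITIONAL —
a real constructive-QFT result; it is NOT the continuum limit and NOT the Clay problem.»  THIS MODULE DISCHARGES NOTHING of the wall: it is [folklore]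
change of variables on the Brillouin zone (a coordinate permutation preserves Lebesgue measure — Mathlib `volume_measurePreserving_piCongrLeft`; the
single-axis flip is leaf-02-g9's `PerfectPropagatorReflection.latticeKernel_cflip`) plus [our object] bookkeeping on the EXPLICIT closed-form symbol of `Δ_∞`
(`PerfectMaxwellDict.deltaZLim_eq_re_latticeKernel` + `bondSymbol`, `PerfectSymbolKMultiplierClosed.GsymInf`, the symbol symmetries `PerfectSymbolPerm.W166Inf_psite` ∕
`W166Inf_cflip`).  The pattern is `PerfectPropagatorReflection.PinfKer_cflip` (the propagator) transcribed to the Hessian.  No `def`, no `def … : Prop`, nothing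
cited as a hypothesis, 0 sorry; 0∕4 row-D1 binders; NOT row H2V-4 as a whole (the S-side letters of the perfect cubic JET stay open, input X1-S♭), NOT D1, NOT
BetaPertH, NOT continuum, NOT Clay.  «not in print; our bookkeeping».

ABSOLUTE RULE (cell charter, verbatim): «No internally-minted statement may enter as a cited fact. Every hypothesis is either kernel-proved in this package or a
verbatim quotation of a PUBLISHED theorem with page reference. The manuscript(s) under audit are NOT citable for their own disputed steps — they are the thing
under adjudication; programme-internal (2001/route/tribunal) claims are never citable.»

WHY (sequel of `FP/PerfectHessianColumnMoments`, owner INTENT journal l.27570): with the moment letters `hM0`, `hM1` and the number `cQ(c, Δ_∞) = c` of that file,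
the present `hP` (permutation covariance of the column through `0`), `hF` (bond reflection law with the shift table `t γ μ ν = [ν=γ] − [μ=γ]`) and `Decays` make
EVERY Hessian-side hypothesis of the road's uniqueness theorem a THEOREM at `M := Δ_∞`.

WHAT.  §1 [folklore] `latticeKernel_psite` (`K[G](σ•x) = K[G ∘ σ•](x)`), [our object] `GsymInf_psite`, `bondSymbol_GsymInf_psite`, **`deltaZLim_psite`**.
§2 [our object] `expFacNeg_cflip` ∕ `expFacPos_cflip` (the re-basing phases `−e^{±iq_γ}` on the reflected axis), `GsymInf_cflip`, `bondSymbol_GsymInf_cflip`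
(uniform factor `Φ⁻_β·Φ⁺_α`), `rebase_eq_sign_phase` (`Φ⁻_β Φ⁺_α = ε_α ε_β e^{iq·s}`, `s = [β=γ]e_γ − [α=γ]e_γ`, on real momenta), **`deltaZLim_cflip`**, **`deltaZLim_cflip_shift`**
(the `hF` spelling: `Δ_∞((cflip γ x + s, α),(0,β)) = ε_α ε_β Δ_∞((x,α),(0,β))`).  §3 [our object] `d + 1 = 4` SOCKET **`admissible_symmetry_letters_deltaZLim`**: for ANY
`M : MKer 4 (Fib 3)` whose field–field block is `Δ_∞` and whose other blocks vanish: `Decays M (c166Z 3) (kappaZ 3)`, and `AdmissibleCubicGerm`'s `hP`, `hF` hold verbatim.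
Provenance: road FP OWNER b2b-balaban-beta-d1-p3 gen 9 (prover-b2b-balaban-beta-d1-p3-g9-0), 2026-08-21, row H2V-4 (R) «perfect Hessian symmetries».
-/

noncomputable section

namespace Summit.QuantumFields.BalabanUV.Beta.FP.PerfectHessianColumnCovariance

open MeasureTheory Set Complex Finset
open scoped Real BigOperators ComplexConjugate
open Literature.MathematicalPhysics.QuantumFieldTheory.Balaban1983to89
open Literature.MathematicalPhysics.QuantumFieldTheory.Balaban1983to89.Beta
open B4Strip (ofRealVec)
open B4ContourShift (BZ phase integrand fourierBox latticeKernel)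
open B4Green244 (phaseC phaseC_ofRealVec latticeKernel_phase_mul latticeKernel_congr)
open B4Green242Bridge (latticeKernel_const_mul)
open B5Symbol166Strip (expFacNeg expFacPos)
open B6BondElimination (unitVec unitVec_apply)
open B12Sec2to5 (l1)
open B4Sect5Exhaustion (K)
open PolarizationSign (reflSign)
open ExpKernelCalculus (MKer Site Decays)
open OneStepResolventKernel (Fib)
open Summit.QuantumFields.BalabanUV.Beta.KernelPermutation (psite psite_apply psite_zero psite_inv_psite psite_psite_inv psite_sub)
open Summit.QuantumFields.BalabanUV.Beta.GAN24.DirichletExhaustionDeltaZ (summand dirI c166Z kappaZ)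
open Summit.QuantumFields.BalabanUV.Beta.GAN24.EffectiveLaplacianLimit (deltaZLim deltaZLim_abs_le_l1)
open Summit.QuantumFields.BalabanUV.Beta.FP.PerfectSymbol166 (W166Inf)
open Summit.QuantumFields.BalabanUV.Beta.FP.PerfectSymbolPerm (cflip cflip_apply cflip_cflip W166Inf_cflip W166Inf_psite ofRealVec_psite psite_mem_BZ)
open Summit.QuantumFields.BalabanUV.Beta.FP.PerfectSymbolKMultiplierClosed (GsymInf)
open Summit.QuantumFields.BalabanUV.Beta.FP.PerfectMaxwellDict (bondSymbol deltaZLim_eq_re_latticeKernel)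
open Summit.QuantumFields.BalabanUV.Beta.FP.PerfectPropagatorReflection (latticeKernel_cflip ofRealVec_cflip phaseC_unitVec phaseC_neg_unitVec
  phaseC_zero_right)

variable {d : ℕ}

/-! ## §1 Axis permutations -/

section Perm

variable (σ : Equiv.Perm (Fin (d + 1)))

/-- [folklore] Mathlib's coordinate-permutation equivalence IS the axis action `psite σ`. -/
theorem piCongrLeft_apply_eq_psite (p : Fin (d + 1) → ℝ) :
    (MeasurableEquiv.piCongrLeft (fun _ : Fin (d + 1) => ℝ) σ) p = psite σ p := by
  funext b
  rw [MeasurableEquiv.coe_piCongrLeft, psite_apply]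
  conv_lhs => rw [← σ.apply_symm_apply b]
  rw [Equiv.piCongrLeft_apply_apply]

/-- [folklore] `(σ•p)·(σ•x) = p·x`. -/
theorem phase_psite_psite (p : Fin (d + 1) → ℝ) (x : Fin (d + 1) → ℤ) : phase (psite σ p) (psite σ x) = phase p x := by
  unfold B4ContourShift.phase
  simp only [psite_apply]
  exact Equiv.sum_comp σ.symm (fun μ => (p μ : ℂ) * (x μ : ℂ))

/-- [folklore] **THE KERNEL AT THE PERMUTED SITE IS THE KERNEL OF THE PERMUTED SYMBOL**: `K[G](σ•x) = K[G ∘ (σ•)](x)` (substitution `p ↦ σ•p` on the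
permutation-invariant zone; Lebesgue measure is invariant). -/
theorem latticeKernel_psite (G : (Fin (d + 1) → ℂ) → ℂ) (x : Fin (d + 1) → ℤ) :
    latticeKernel G (psite σ x) = latticeKernel (fun q => G (psite σ q)) x := by
  unfold latticeKernel B4ContourShift.fourierBox
  congr 1
  set e := MeasurableEquiv.piCongrLeft (fun _ : Fin (d + 1) => ℝ) σ with he
  have hcoe : ∀ p, e p = psite σ p := piCongrLeft_apply_eq_psite σ
  have hmp : MeasurePreserving e := volume_measurePreserving_piCongrLeft (fun _ : Fin (d + 1) => ℝ) σ
  have h := hmp.setIntegral_preimage_emb e.measurableEmbedding (B4ContourShift.integrand G (psite σ x)) (BZ (d + 1))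
  have hpre : e ⁻¹' BZ (d + 1) = BZ (d + 1) := by
    ext p
    rw [Set.mem_preimage, hcoe]
    refine ⟨fun hp => ?_, fun hp => psite_mem_BZ σ hp⟩
    have := psite_mem_BZ σ⁻¹ hp
    rwa [psite_inv_psite] at this
  rw [hpre] at h
  rw [← h]
  refine setIntegral_congr_fun measurableSet_Icc fun p _ => ?_
  unfold B4ContourShift.integrand
  rw [hcoe, ← ofRealVec_psite, phase_psite_psite]

/-- [our object] the form factors are permutation covariant: `(e^{−i(σ•q)_{σa}} − 1) = (e^{−iq_a} − 1)`, and likewise for `e^{+i·}`. -/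
theorem expFac_psite (a : Fin (d + 1)) (q : Fin (d + 1) → ℂ) :
    expFacNeg (σ a) (psite σ q) = expFacNeg a q ∧ expFacPos (σ a) (psite σ q) = expFacPos a q := by
  unfold expFacNeg expFacPos
  simp only [psite_apply, Equiv.symm_apply_apply, and_self]

/-- [our object] **THE CLOSED-FORM ENTRY SYMBOL IS PERMUTATION COVARIANT**: `G_∞(σμ σν; σa σb)(σ•q) = G_∞(μν;ab)(q)` (`W166Inf_psite` + `expFac_psite`). -/
theorem GsymInf_psite (μ ν a b : Fin (d + 1)) (q : Fin (d + 1) → ℂ) :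
    GsymInf (σ μ) (σ ν) (σ a) (σ b) (psite σ q) = GsymInf μ ν a b q := by
  unfold GsymInf
  rw [W166Inf_psite, (expFac_psite σ a q).1, (expFac_psite σ b q).2]

/-- [folklore] the bond-direction Kronecker symbol is permutation invariant. -/
theorem dirI_perm (κ α : Fin (d + 1)) : dirI (σ κ) (σ α) = dirI κ α := by
  unfold dirI
  by_cases h : κ = α
  · rw [if_pos h, if_pos (congrArg σ h)]
  · rw [if_neg h, if_neg (fun h' => h (σ.injective h'))]

/-- [our object] **THE BOND-BASIS SYMBOL MATRIX OF `Δ_∞` IS PERMUTATION COVARIANT**: `B_{σα σβ}(σ•q) = B_{αβ}(q)` (re-index the double direction sum by `σ`). -/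
theorem bondSymbol_GsymInf_psite (α β : Fin (d + 1)) (q : Fin (d + 1) → ℂ) :
    bondSymbol GsymInf (σ α) (σ β) (psite σ q) = bondSymbol GsymInf α β q := by
  unfold bondSymbol
  rw [← Equiv.sum_comp σ]
  refine Finset.sum_congr rfl fun μ _ => ?_
  rw [← Equiv.sum_comp σ]
  refine Finset.sum_congr rfl fun ν _ => ?_
  simp only [σ.injective.eq_iff, dirI_perm, GsymInf_psite]

/-- [our object] **`Δ_∞` IS COVARIANT UNDER THE AXIS PERMUTATIONS OF `ℤ^{d+1}`**: `Δ_∞((σ•x, σα),(σ•y, σβ)) = Δ_∞((x,α),(y,β))` for every `σ ∈ S_{d+1}` — B12 (1.21)'s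
lattice-rotation covariance (the coordinate permutations) for the PERFECT Hessian, as an identity of the explicit object. -/
theorem deltaZLim_psite (x y : Fin (d + 1) → ℤ) (α β : Fin (d + 1)) :
    deltaZLim (d := d) (psite σ x, σ α) (psite σ y, σ β) = deltaZLim (x, α) (y, β) := by
  rw [deltaZLim_eq_re_latticeKernel, deltaZLim_eq_re_latticeKernel]
  dsimp only
  rw [← psite_sub, latticeKernel_psite]
  congr 2
  funext q
  exact bondSymbol_GsymInf_psite σ α β q

end Perm

/-! ## §2 Single-axis reflections -/

section Refl

variable (γ : Fin (d + 1))

/-- [our object] **THE FORM FACTORS AT THE FLIPPED MOMENTUM**: on the reflected axis `e^{−i(−q_γ)} − 1 = −e^{iq_γ}·(e^{−iq_γ} − 1)` and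
`e^{i(−q_γ)} − 1 = −e^{−iq_γ}·(e^{iq_γ} − 1)`; off it nothing changes. -/
theorem expFac_cflip (a : Fin (d + 1)) (q : Fin (d + 1) → ℂ) :
    expFacNeg a (cflip γ q) = (if a = γ then -cexp (q γ * I) else 1) * expFacNeg a q ∧
      expFacPos a (cflip γ q) = (if a = γ then -cexp (-(q γ * I)) else 1) * expFacPos a q := by
  unfold expFacNeg expFacPos
  by_cases ha : a = γ
  · subst ha
    simp only [cflip_apply, if_true]
    have h : cexp (q a * I) * cexp (-(q a * I)) = 1 := by rw [← Complex.exp_add, add_neg_cancel, Complex.exp_zero]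
    constructor
    · rw [show -((-q a) * I) = q a * I by ring]
      linear_combination h
    · rw [show (-q a) * I = -(q a * I) by ring]
      linear_combination h
  · simp only [cflip_apply, ha, if_false, one_mul, and_self]

/-- [our object] **THE ENTRY SYMBOL AT THE FLIPPED MOMENTUM**: `G_∞(μν;ab)(cflip γ q) = Φ⁻_a·Φ⁺_b·G_∞(μν;ab)(q)` with `Φ⁻_a = [a=γ](−e^{iq_γ}) + [a≠γ]`,
`Φ⁺_b = [b=γ](−e^{−iq_γ}) + [b≠γ]` (`W_∞` is flip-even, `W166Inf_cflip`). -/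
theorem GsymInf_cflip (μ ν a b : Fin (d + 1)) (q : Fin (d + 1) → ℂ) :
    GsymInf μ ν a b (cflip γ q) =
      (if a = γ then -cexp (q γ * I) else 1) * (if b = γ then -cexp (-(q γ * I)) else 1) * GsymInf μ ν a b q := by
  unfold GsymInf
  rw [W166Inf_cflip, (expFac_cflip γ a q).1, (expFac_cflip γ b q).2]
  ring

/-- [our object] on a diagonal word the two re-basing phases cancel: `Φ⁻_c·Φ⁺_c = 1`. -/
theorem rebase_self (c : Fin (d + 1)) (q : Fin (d + 1) → ℂ) :
    (if c = γ then -cexp (q γ * I) else (1 : ℂ)) * (if c = γ then -cexp (-(q γ * I)) else 1) = 1 := by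
  by_cases hc : c = γ
  · simp only [hc, if_true]
    rw [neg_mul_neg, ← Complex.exp_add, add_neg_cancel, Complex.exp_zero]
  · simp [hc]

/-- [our object] **THE BOND-BASIS SYMBOL MATRIX OF `Δ_∞` AT THE FLIPPED MOMENTUM** picks up the UNIFORM factor `Φ⁻_β·Φ⁺_α`: in each of the four words of
`bondSymbol` the Kronecker symbols tie the bond directions `(a,b)` to `(β,α)` (mixed words) or to a common value (diagonal words, where `Φ⁻Φ⁺ = 1 = Φ⁻_βΦ⁺_α`). -/
theorem bondSymbol_GsymInf_cflip (α β : Fin (d + 1)) (q : Fin (d + 1) → ℂ) :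
    bondSymbol GsymInf α β (cflip γ q) =
      (if β = γ then -cexp (q γ * I) else 1) * (if α = γ then -cexp (-(q γ * I)) else 1) * bondSymbol GsymInf α β q := by
  unfold bondSymbol
  rw [Finset.mul_sum]
  refine Finset.sum_congr rfl fun μ _ => ?_
  rw [Finset.mul_sum]
  refine Finset.sum_congr rfl fun ν _ => ?_
  by_cases hμν : μ = ν
  · simp only [hμν, if_true, mul_zero]
  rw [if_neg hμν, if_neg hμν]
  simp only [GsymInf_cflip]
  -- the four words: the Kronecker factors decide the indices
  have hdd : ∀ (c e e' : Fin (d + 1)), ((dirI c e * dirI c e' : ℝ) : ℂ) *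
      ((if μ = γ then -cexp (q γ * I) else 1) * (if μ = γ then -cexp (-(q γ * I)) else 1) * GsymInf μ ν μ μ q) =
      ((if e' = γ then -cexp (q γ * I) else 1) * (if e = γ then -cexp (-(q γ * I)) else 1)) *
        (((dirI c e * dirI c e' : ℝ) : ℂ) * GsymInf μ ν μ μ q) := by
    intro c e e'
    by_cases h1 : c = e
    · by_cases h2 : c = e'
      · subst h1; subst h2
        rw [rebase_self, rebase_self]; ring
      · simp [dirI, h2]
    · simp [dirI, h1]
  have hdd' : ∀ (c e e' : Fin (d + 1)), ((dirI c e * dirI c e' : ℝ) : ℂ) *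
      ((if ν = γ then -cexp (q γ * I) else 1) * (if ν = γ then -cexp (-(q γ * I)) else 1) * GsymInf μ ν ν ν q) =
      ((if e' = γ then -cexp (q γ * I) else 1) * (if e = γ then -cexp (-(q γ * I)) else 1)) *
        (((dirI c e * dirI c e' : ℝ) : ℂ) * GsymInf μ ν ν ν q) := by
    intro c e e'
    by_cases h1 : c = e
    · by_cases h2 : c = e'
      · subst h1; subst h2
        rw [rebase_self, rebase_self]; ring
      · simp [dirI, h2]
    · simp [dirI, h1]
  have hmx : ∀ (X : ℂ), ((dirI ν α * dirI μ β : ℝ) : ℂ) *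
      ((if μ = γ then -cexp (q γ * I) else 1) * (if ν = γ then -cexp (-(q γ * I)) else 1) * X) =
      ((if β = γ then -cexp (q γ * I) else 1) * (if α = γ then -cexp (-(q γ * I)) else 1)) * (((dirI ν α * dirI μ β : ℝ) : ℂ) * X) := by
    intro X
    by_cases h1 : ν = α
    · by_cases h2 : μ = β
      · subst h1; subst h2; ring
      · simp [dirI, h2]
    · simp [dirI, h1]
  have hmx' : ∀ (X : ℂ), ((dirI μ α * dirI ν β : ℝ) : ℂ) *
      ((if ν = γ then -cexp (q γ * I) else 1) * (if μ = γ then -cexp (-(q γ * I)) else 1) * X) =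
      ((if β = γ then -cexp (q γ * I) else 1) * (if α = γ then -cexp (-(q γ * I)) else 1)) * (((dirI μ α * dirI ν β : ℝ) : ℂ) * X) := by
    intro X
    by_cases h1 : μ = α
    · by_cases h2 : ν = β
      · subst h1; subst h2; ring
      · simp [dirI, h2]
    · simp [dirI, h1]
  rw [hdd ν α β, hdd' μ α β, hmx, hmx']
  ring

/-- [folklore] on real momenta the uniform factor is a SIGN times a UNIT-SHIFT PHASE: `Φ⁻_β·Φ⁺_α = ε_α ε_β·e^{iq·s}`, `s = [β=γ]e_γ − [α=γ]e_γ` (`ε = reflSign γ`). -/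
theorem rebase_eq_sign_phase (α β : Fin (d + 1)) (p : Fin (d + 1) → ℝ) :
    (if β = γ then -cexp ((ofRealVec p) γ * I) else (1 : ℂ)) * (if α = γ then -cexp (-((ofRealVec p) γ * I)) else 1) =
      cexp (I * phaseC (ofRealVec p) ((if β = γ then unitVec γ else 0) - (if α = γ then unitVec γ else 0))) *
        ((reflSign γ α * reflSign γ β : ℝ) : ℂ) := by
  have hq : (ofRealVec p) γ = (p γ : ℂ) := rfl
  by_cases hβ : β = γ <;> by_cases hα : α = γ
  · simp only [hβ, hα, if_true, reflSign, sub_self, phaseC_zero_right, mul_zero, Complex.exp_zero, one_mul]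
    push_cast
    rw [neg_mul_neg, ← Complex.exp_add, add_neg_cancel, Complex.exp_zero]; norm_num
  · simp only [hβ, hα, if_true, if_false, reflSign, sub_zero, phaseC_unitVec, hq, mul_one, one_mul]
    push_cast
    rw [show I * (p γ : ℂ) = (p γ : ℂ) * I by ring]; ring
  · simp only [hβ, hα, if_true, if_false, reflSign, zero_sub, phaseC_neg_unitVec, hq, mul_one, one_mul]
    push_cast
    rw [show I * -(p γ : ℂ) = -((p γ : ℂ) * I) by ring]; ring
  · simp only [hβ, hα, if_false, reflSign, sub_self, phaseC_zero_right, mul_zero, Complex.exp_zero, one_mul]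
    push_cast; ring

/-- [our object] **THE SINGLE-AXIS REFLECTION LAW OF `Δ_∞`** (column through the bond `(0,β)`):
`Δ_∞((cflip γ x, α),(0,β)) = ε_α ε_β · Δ_∞((x + [β=γ]e_γ − [α=γ]e_γ, α),(0,β))` — change of variables `latticeKernel_cflip`, the flipped symbol
`bondSymbol_GsymInf_cflip` ∕ `rebase_eq_sign_phase`, the phase shifts the site (`latticeKernel_phase_mul`). -/
theorem deltaZLim_cflip (x : Fin (d + 1) → ℤ) (α β : Fin (d + 1)) :
    deltaZLim (d := d) (cflip γ x, α) (0, β) =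
      reflSign γ α * reflSign γ β * deltaZLim (x + ((if β = γ then unitVec γ else 0) - (if α = γ then unitVec γ else 0)), α) (0, β) := by
  rw [deltaZLim_eq_re_latticeKernel, deltaZLim_eq_re_latticeKernel]
  dsimp only
  rw [sub_zero, sub_zero, latticeKernel_cflip]
  rw [latticeKernel_congr (G2 := fun q => cexp (I * phaseC q ((if β = γ then unitVec γ else 0) - (if α = γ then unitVec γ else 0)))
      * ((fun q => ((reflSign γ α * reflSign γ β : ℝ) : ℂ) * bondSymbol GsymInf α β q) q)) (fun p _ => by
        rw [bondSymbol_GsymInf_cflip, rebase_eq_sign_phase]; beta_reduce; ring)]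
  rw [latticeKernel_phase_mul, latticeKernel_const_mul, Complex.re_ofReal_mul]

/-- [folklore] re-basing the reflected site: `cflip γ (x − s) = cflip γ x + s` for a vector `s` supported on the axis `γ`. -/
theorem cflip_sub_axis (x : Fin (d + 1) → ℤ) (α β : Fin (d + 1)) :
    cflip γ (x - ((if β = γ then unitVec γ else 0) - (if α = γ then unitVec γ else 0))) =
      cflip γ x + ((if β = γ then unitVec γ else 0) - (if α = γ then unitVec γ else 0)) := by
  funext i
  simp only [cflip_apply, Pi.add_apply, Pi.sub_apply]
  by_cases hi : i = γ <;> by_cases hβ : β = γ <;> by_cases hα : α = γ <;> simp [hi, hβ, hα, unitVec_apply] <;> ring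

/-- [our object] **THE `hF` SPELLING OF THE REFLECTION LAW**: `Δ_∞((cflip γ x + [β=γ]e_γ − [α=γ]e_γ, α),(0,β)) = ε_α ε_β · Δ_∞((x,α),(0,β))`
(`deltaZLim_cflip` at the site `x − s`). -/
theorem deltaZLim_cflip_shift (x : Fin (d + 1) → ℤ) (α β : Fin (d + 1)) :
    deltaZLim (d := d) (cflip γ x + ((if β = γ then unitVec γ else 0) - (if α = γ then unitVec γ else 0)), α) (0, β) =
      reflSign γ α * reflSign γ β * deltaZLim (x, α) (0, β) := by
  have h := deltaZLim_cflip (d := d) γ (x - ((if β = γ then unitVec γ else 0) - (if α = γ then unitVec γ else 0))) α β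
  rwa [cflip_sub_axis, sub_add_cancel] at h

end Refl

/-! ## §3 The socket at `d + 1 = 4` -/

section Socket

/-- [our object] **THE HESSIAN-SIDE SYMMETRY LETTERS OF `AdmissibleCubicGerm` AT THE PERFECT DATA**: for ANY packed kernel `M : MKer 4 (Fib 3)` whose
field–field block is `Δ_∞` and whose field–multiplier, multiplier–field and multiplier–multiplier blocks vanish: (i) `Decays M (c166Z 3) (kappaZ 3)`;
(ii) `hP` — `M (x ∘ σ⁻¹) 0 (inl σμ) (inl σν) = M x 0 (inl μ) (inl ν)`; (iii) `hF` with the shift table `t γ μ ν := [ν=γ] − [μ=γ]` —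
`M (fun i => if i = γ then −x i + t γ μ ν else x i) 0 (inl μ) (inl ν) = ε_μ ε_ν · M x 0 (inl μ) (inl ν)`, `ε = reflSign γ` (= `MarginalUniqueness.rs γ`). -/
theorem admissible_symmetry_letters_deltaZLim {M : MKer (3 + 1) (Fib 3)}
    (hff : ∀ (x y : Fin (3 + 1) → ℤ) (μ ν : Fin (3 + 1)), M x y (Sum.inl μ) (Sum.inl ν) = deltaZLim (d := 3) (x, μ) (y, ν))
    (hfm : ∀ (x y : Fin (3 + 1) → ℤ) (μ ν : Fin (3 + 1)), M x y (Sum.inl μ) (Sum.inr ν) = 0)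
    (hmf : ∀ (x y : Fin (3 + 1) → ℤ) (μ ν : Fin (3 + 1)), M x y (Sum.inr μ) (Sum.inl ν) = 0)
    (hmm : ∀ (x y : Fin (3 + 1) → ℤ) (μ ν : Fin (3 + 1)), M x y (Sum.inr μ) (Sum.inr ν) = 0) :
    Decays M (c166Z 3) (kappaZ 3) ∧
      (∀ (σ : Equiv.Perm (Fin (3 + 1))) (x : Fin (3 + 1) → ℤ) (μ ν : Fin (3 + 1)),
        M (fun i => x (σ.symm i)) 0 (Sum.inl (σ μ)) (Sum.inl (σ ν)) = M x 0 (Sum.inl μ) (Sum.inl ν)) ∧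
      (∀ (γ : Fin (3 + 1)) (x : Fin (3 + 1) → ℤ) (μ ν : Fin (3 + 1)),
        M (fun i => if i = γ then -x i + ((if ν = γ then (1 : ℤ) else 0) - (if μ = γ then 1 else 0)) else x i) 0 (Sum.inl μ) (Sum.inl ν) =
          reflSign γ μ * reflSign γ ν * M x 0 (Sum.inl μ) (Sum.inl ν)) := by
  refine ⟨?_, ?_, ?_⟩
  · intro x y a b
    have hC : 0 ≤ c166Z 3 * Real.exp (-(kappaZ 3) * l1 (x - y)) := by
      have h := deltaZLim_abs_le_l1 (d := 3) (x, (0 : Fin (3 + 1))) (y, 0)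
      exact le_trans (abs_nonneg _) (by simpa [neg_mul] using h)
    rcases a with μ | μ <;> rcases b with ν | ν
    · rw [hff]
      have h := deltaZLim_abs_le_l1 (d := 3) (x, μ) (y, ν)
      simpa [neg_mul] using h
    · rw [hfm, abs_zero]; exact hC
    · rw [hmf, abs_zero]; exact hC
    · rw [hmm, abs_zero]; exact hC
  · intro σ x μ ν
    rw [hff, hff, show (fun i => x (σ.symm i)) = psite σ x from rfl]
    have h := deltaZLim_psite (d := 3) σ x 0 μ ν
    rwa [psite_zero] at h
  · intro γ x μ ν
    rw [hff, hff]
    have h := deltaZLim_cflip_shift (d := 3) γ x μ ν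
    have e : (cflip γ x + ((if ν = γ then unitVec γ else 0) - (if μ = γ then unitVec γ else 0)) : Fin (3 + 1) → ℤ) =
        fun i => if i = γ then -x i + ((if ν = γ then (1 : ℤ) else 0) - (if μ = γ then 1 else 0)) else x i := by
      funext i
      simp only [Pi.add_apply, Pi.sub_apply, cflip_apply]
      by_cases hi : i = γ <;> by_cases hν : ν = γ <;> by_cases hμ : μ = γ <;> simp [hi, hν, hμ, unitVec_apply]
    rw [e] at h
    exact h

end Socket

end Summit.QuantumFields.BalabanUV.Beta.FP.PerfectHessianColumnCovariance

end
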